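import Literature.Analysis.FluidPDE.CaloricPotentialContinuity
import Literature.Analysis.FluidPDE.HeatNewtonOffDiagonal
import HarnessLib

/-!
# The backward kernel families of the caloric duality argument and their potential estimates

Analysis/FluidPDE support file for the discharge of the named fact
`Literature.Analysis.FluidPDE.NSBoundedInteriorContinuity` (`NSBoundedInteriorRegularity.lean`;
Seregin–Šverák 2009, §2). It bundles the kernel hypotheses of the two continuity theorems of
`CaloricPotentialContinuity.lean` into predicates and verifies them for the six families of
backward kernels (`CaloricBackwardKernels.backKernel`) that appear in the duality identity:

* `IsSliceBoundKernel K N` — the hypotheses of `continuous_convolution_of_sliceBound`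
  (measurable, `∫ |K(τ, ·)| ≤ N(τ)` with `N ≥ 0` locally integrable, bounded on `{ε ≤ |τ|}`,
  continuous off `τ = 0`), with the wrappers `IsSliceBoundKernel.continuous_convolution` and
  `IsSliceBoundKernel.integrable_kernelPairing`;
* `IsOffDiagKernel K D` — the hypotheses of `continuousOn_convolution_of_offDiag` (measurable,
  bounded on `ℝ × D`, continuous at `(τ, y)` for `τ ≠ 0`, `y ∈ D`), with the wrappers
  `IsOffDiagKernel.continuousOn_convolution` and `IsOffDiagKernel.integrable_kernelPairing`;
* instances (dimension three for the Newtonian families, `Γ₀ = newtonNear r₀ r₁`,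
  `λ = newtonFarLaplacian r₀ r₁`, `0 < r₀ < r₁`):
  the heat kernel `G` (slice bound `1`; off-diagonal on `{δ ≤ ‖y‖}`), its gradient `∂ᵥG`
  (slice bound `2^{d/2}‖v‖(1 + |τ|^{-1/2})`), `heatD1 · c Γ₀` (slice bound
  `2^{3/2}‖c‖‖Γ₀‖₁(1 + |τ|^{-1/2})`; off-diagonal), `heatD2 · v c Γ₀` (off-diagonal),
  `heatD3 · u v w Γ₀` for `‖u‖, ‖v‖, ‖w‖ ≤ 1` (slice bound `C(1 + |τ|^{-1/2})` of
  `HeatNewtonIdentity.lean`), and `heatD1 · c λ` (off-diagonal with `D = univ`).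

Everything is proved; the analytic inputs are `CaloricBackwardKernels.lean`,
`HeatNewtonIdentity.lean` (the `L¹` bound for the third derivatives) and
`HeatNewtonOffDiagonal.lean` (the off-diagonal bounds).
-/

noncomputable section

open MeasureTheory Set Function Filter Metric Real ContinuousLinearMap
open scoped ENNReal NNReal Topology RealInnerProductSpace Convolution

namespace Literature.Analysis.FluidPDE

section General

variable {E : Type*} [NormedAddCommGroup E] [InnerProductSpace ℝ E] [FiniteDimensional ℝ E]
  [MeasurableSpace E] [BorelSpace E]

/-! ### The two kernel classes -/

/-- **Kernels with integrable time-slice bound** (the hypotheses of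
`continuous_convolution_of_sliceBound`): `K : ℝ × E → ℝ` is measurable, its time slices satisfy
`∫ |K(τ, y)| dy ≤ N(τ)` with `N ≥ 0` locally integrable, `K` is bounded on `{ε ≤ |τ|}` for every
`ε > 0`, and continuous at every point with `τ ≠ 0`. [folklore] -/
structure IsSliceBoundKernel (K : ℝ × E → ℝ) (N : ℝ → ℝ) : Prop where
  /-- measurability -/
  measurable : Measurable K
  /-- the time-slice bound -/
  slice_le : ∀ τ : ℝ, ∫⁻ y, ‖K (τ, y)‖ₑ ≤ ENNReal.ofReal (N τ)
  /-- the majorant is nonnegative -/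
  nonneg : ∀ τ, 0 ≤ N τ
  /-- the majorant is locally integrable -/
  locallyIntegrable : LocallyIntegrable N volume
  /-- boundedness away from the slice `τ = 0` -/
  bdd : ∀ ε : ℝ, 0 < ε → ∃ B : ℝ, ∀ p : ℝ × E, ε ≤ |p.1| → |K p| ≤ B
  /-- continuity off the slice `τ = 0` -/
  continuousAt : ∀ p : ℝ × E, p.1 ≠ 0 → ContinuousAt K p

/-- **Kernels bounded off the diagonal** (the hypotheses of `continuousOn_convolution_of_offDiag`):
`K` is measurable, bounded on `ℝ × D`, and continuous at every `(τ, y)` with `τ ≠ 0`, `y ∈ D`.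
[folklore] -/
structure IsOffDiagKernel (K : ℝ × E → ℝ) (D : Set E) : Prop where
  /-- measurability -/
  measurable : Measurable K
  /-- boundedness on `ℝ × D` -/
  bdd : ∃ B : ℝ, ∀ τ : ℝ, ∀ y ∈ D, |K (τ, y)| ≤ B
  /-- continuity on `ℝ × D` off the slice `τ = 0` -/
  continuousAt : ∀ τ : ℝ, τ ≠ 0 → ∀ y ∈ D, ContinuousAt K (τ, y)

variable {K : ℝ × E → ℝ} {N : ℝ → ℝ} {D : Set E}

/-- **Potentials of bounded data against slice-bound kernels are continuous**
(wrapper of `continuous_convolution_of_sliceBound`). [folklore] -/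
theorem IsSliceBoundKernel.continuous_convolution (hK : IsSliceBoundKernel K N) {f : ℝ × E → ℝ}
    {M a b : ℝ} (hfint : Integrable f volume) (hM : 0 ≤ M)
    (hfM : ∀ᵐ z ∂(volume : Measure (ℝ × E)), |f z| ≤ M)
    (hfsupp : ∀ᵐ z ∂(volume : Measure (ℝ × E)), f z ≠ 0 → z.1 ∈ Icc a b) :
    Continuous (K ⋆[lsmul ℝ ℝ, (volume : Measure (ℝ × E))] f) :=
  continuous_convolution_of_sliceBound hK.measurable hK.slice_le hK.nonneg hK.locallyIntegrable
    hK.bdd hK.continuousAt hfint hM hfM hfsupp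

/-- The reflected kernel `Ǩ(v) = K(-v)` of a slice-bound kernel is slice-bound with the reflected
majorant. [folklore] -/
theorem IsSliceBoundKernel.reflect (hK : IsSliceBoundKernel K N) :
    IsSliceBoundKernel (fun v => K (-v)) (fun τ => N (-τ)) where
  measurable := hK.measurable.comp measurable_neg
  slice_le τ := by
    have h := hK.slice_le (-τ)
    calc ∫⁻ y, ‖K (-(τ, y))‖ₑ = ∫⁻ y, ‖K (-τ, -y)‖ₑ := by rfl
      _ = ∫⁻ y, ‖K (-τ, y)‖ₑ := lintegral_neg_eq_self (fun y => ‖K (-τ, y)‖ₑ)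
      _ ≤ ENNReal.ofReal (N (-τ)) := h
  nonneg τ := hK.nonneg (-τ)
  locallyIntegrable := by
    refine locallyIntegrable_iff.2 fun C hC => ?_
    have hmp : MeasurePreserving (fun τ : ℝ => -τ) volume volume := Measure.measurePreserving_neg volume
    have hpre : (fun τ : ℝ => -τ) ⁻¹' ((fun τ : ℝ => -τ) ⁻¹' C) = C := by ext τ; simp
    have h := (hmp.integrableOn_comp_preimage (Homeomorph.neg ℝ).measurableEmbedding
      (f := N) (s := (fun τ : ℝ => -τ) ⁻¹' C)).2
      (hK.locallyIntegrable.integrableOn_isCompact (by simpa using hC.neg))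
    rw [hpre] at h
    exact h
  bdd ε hε := by
    obtain ⟨B, hB⟩ := hK.bdd ε hε
    exact ⟨B, fun p hp => hB (-p) (by simpa using hp)⟩
  continuousAt p hp := by
    have h := hK.continuousAt (-p) (by simpa using hp)
    exact h.comp_of_eq continuous_neg.continuousAt rfl

/-- The reflected kernel of an off-diagonal kernel on a symmetric region is off-diagonal.
[folklore] -/
theorem IsOffDiagKernel.reflect (hK : IsOffDiagKernel K D) (hD : ∀ y ∈ D, -y ∈ D) :
    IsOffDiagKernel (fun v => K (-v)) D where
  measurable := hK.measurable.comp measurable_neg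
  bdd := by
    obtain ⟨B, hB⟩ := hK.bdd
    exact ⟨B, fun τ y hy => by simpa using hB (-τ) (-y) (hD y hy)⟩
  continuousAt τ hτ y hy := by
    have h := hK.continuousAt (-τ) (neg_ne_zero.2 hτ) (-y) (hD y hy)
    exact h.comp_of_eq continuous_neg.continuousAt (by simp)

/-- **Off-diagonal potentials of integrable data are continuous on separated sets**
(wrapper of `continuousOn_convolution_of_offDiag`). [folklore] -/
theorem IsOffDiagKernel.continuousOn_convolution (hK : IsOffDiagKernel K D) {f : ℝ × E → ℝ}
    {A : Set E} {U : Set (ℝ × E)} (hf : Integrable f volume)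
    (hfA : ∀ᵐ w ∂(volume : Measure (ℝ × E)), f w ≠ 0 → w.2 ∈ A) (hU : IsOpen U)
    (hUA : ∀ z ∈ U, ∀ a ∈ A, z.2 - a ∈ D) :
    ContinuousOn (K ⋆[lsmul ℝ ℝ, (volume : Measure (ℝ × E))] f) U := by
  obtain ⟨B, hB⟩ := hK.bdd
  exact continuousOn_convolution_of_offDiag hK.measurable hB hK.continuousAt hf hfA hU hUA

/-- Absolute convergence of the duality pairing for an off-diagonal kernel (wrapper of
`integrable_kernelPairing_of_offDiag`). [folklore] -/
theorem IsOffDiagKernel.integrable_kernelPairing (hK : IsOffDiagKernel K D) {f g : ℝ × E → ℝ}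
    {A : Set E} (hf : Integrable f volume)
    (hfA : ∀ᵐ z ∂(volume : Measure (ℝ × E)), f z ≠ 0 → z.2 ∈ A) (hg : Integrable g volume)
    (hgD : ∀ w, g w ≠ 0 → ∀ a ∈ A, a - w.2 ∈ D) :
    Integrable (fun p : (ℝ × E) × (ℝ × E) => f p.1 * (K (p.1 - p.2) * g p.2))
      ((volume : Measure (ℝ × E)).prod volume) := by
  obtain ⟨B, hB⟩ := hK.bdd
  exact integrable_kernelPairing_of_offDiag hK.measurable hB hf hfA hg hgD

/-- Absolute convergence of the duality pairing for a slice-bound kernel (wrapper of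
`integrable_kernelPairing_of_sliceBound`). [folklore] -/
theorem IsSliceBoundKernel.integrable_kernelPairing (hK : IsSliceBoundKernel K N) {f g : ℝ × E → ℝ}
    {M a b a' b' : ℝ} (hf : AEStronglyMeasurable f volume) (hM : 0 ≤ M)
    (hfM : ∀ᵐ z ∂(volume : Measure (ℝ × E)), |f z| ≤ M)
    (hfsupp : ∀ᵐ z ∂(volume : Measure (ℝ × E)), f z ≠ 0 → z.1 ∈ Icc a b)
    (hg : Integrable g volume) (hgsupp : ∀ w, g w ≠ 0 → w.1 ∈ Icc a' b') :
    Integrable (fun p : (ℝ × E) × (ℝ × E) => f p.1 * (K (p.1 - p.2) * g p.2))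
      ((volume : Measure (ℝ × E)).prod volume) :=
  integrable_kernelPairing_of_sliceBound hK.measurable hK.slice_le hK.nonneg
    (hK.locallyIntegrable.integrableOn_isCompact isCompact_Icc) hf hM hfM hfsupp hg hgsupp

/-! ### Backward kernels from families: the two classes -/

/-- **A backward kernel is slice-bound** as soon as the family is jointly continuous on
`(0, ∞) × E`, bounded for `a ≥ ε`, and has slices bounded by `C (1 + a^{-1/2})`. [folklore] -/
theorem isSliceBoundKernel_backKernel {κ : ℝ → E → ℝ} {C : ℝ} (hC : 0 ≤ C)
    (hκ : ContinuousOn (fun q : ℝ × E => κ q.1 q.2) (Ioi 0 ×ˢ univ))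
    (hbdd : ∀ ε : ℝ, 0 < ε → ∃ B : ℝ, 0 ≤ B ∧ ∀ a, ε ≤ a → ∀ y, |κ a y| ≤ B)
    (hslice : ∀ a : ℝ, 0 < a → ∫⁻ y, ‖κ a y‖ₑ ≤ ENNReal.ofReal (C * (1 + |a| ^ (-(1 / 2 : ℝ))))) :
    IsSliceBoundKernel (backKernel κ) (fun τ => C * (1 + |τ| ^ (-(1 / 2 : ℝ)))) where
  measurable := measurable_backKernel hκ
  slice_le τ := by
    have h := lintegral_enorm_backKernel_le (κ := κ) (N₀ := fun a => C * (1 + |a| ^ (-(1 / 2 : ℝ))))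
      hslice τ
    simpa only [abs_abs] using h
  nonneg τ := const_mul_one_add_abs_rpow_nonneg hC τ
  locallyIntegrable := locallyIntegrable_const_mul_one_add_abs_rpow C
  bdd ε hε := by
    obtain ⟨B, hB0, hB⟩ := hbdd ε hε
    exact ⟨B, fun p hp => abs_backKernel_le_of_le_abs hB0 hB p hp⟩
  continuousAt := continuousAt_backKernel hκ

omit [InnerProductSpace ℝ E] [FiniteDimensional ℝ E] in
/-- **A backward kernel is off-diagonal on `D`** as soon as the family is jointly continuous on
`(0, ∞) × E` and bounded on `D` uniformly in `a > 0`. [folklore] -/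
theorem isOffDiagKernel_backKernel {κ : ℝ → E → ℝ} {D : Set E}
    (hκ : ContinuousOn (fun q : ℝ × E => κ q.1 q.2) (Ioi 0 ×ˢ univ))
    (hbdd : ∃ B : ℝ, 0 ≤ B ∧ ∀ a, 0 < a → ∀ y ∈ D, |κ a y| ≤ B) :
    IsOffDiagKernel (backKernel κ) D where
  measurable := measurable_backKernel hκ
  bdd := by
    obtain ⟨B, hB0, hB⟩ := hbdd
    exact ⟨B, fun τ y hy => abs_backKernel_le_on hB0 hB τ y hy⟩
  continuousAt := continuousAt_backKernel_on hκ D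

/-! ### The heat kernel and its gradient -/

/-- The backward heat kernel is slice-bound with `N = 1·(1 + |τ|^{-1/2})` (indeed with `N = 1`).
[folklore] -/
theorem isSliceBoundKernel_backKernel_heatKernel :
    IsSliceBoundKernel (backKernel (UnboundedOperators.heatKernel (E := E)))
      (fun τ => 1 * (1 + |τ| ^ (-(1 / 2 : ℝ)))) := by
  refine isSliceBoundKernel_backKernel zero_le_one continuousOn_heatKernel_family
    (fun ε hε => ⟨(4 * π * ε) ^ (-(Module.finrank ℝ E : ℝ) / 2), by positivity,
      fun a ha y => abs_heatKernel_le_of_le hε ha y⟩) fun a ha => ?_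
  refine (lintegral_enorm_heatKernel_le_one ha).trans (ENNReal.ofReal_le_ofReal ?_)
  have : 0 ≤ |a| ^ (-(1 / 2 : ℝ)) := Real.rpow_nonneg (abs_nonneg a) _
  linarith

omit [FiniteDimensional ℝ E] in
/-- The backward heat kernel is off-diagonal on `{δ ≤ ‖y‖}` for `δ > 0`. [folklore] -/
theorem isOffDiagKernel_backKernel_heatKernel {δ : ℝ} (hδ : 0 < δ) :
    IsOffDiagKernel (backKernel (UnboundedOperators.heatKernel (E := E))) {y | δ ≤ ‖y‖} := by
  obtain ⟨C, hC, h⟩ := exists_heatKernel_le_of_le_norm (E := E)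
  refine isOffDiagKernel_backKernel continuousOn_heatKernel_family
    ⟨C * δ ^ (-(Module.finrank ℝ E : ℝ)), ?_, fun a ha y hy => h ha hδ y hy⟩
  have : 0 ≤ δ ^ (-(Module.finrank ℝ E : ℝ)) := Real.rpow_nonneg hδ.le _
  positivity

/-- The backward heat-gradient kernel is slice-bound with
`N = 2^{d/2}‖v‖(1 + |τ|^{-1/2})`. [folklore] -/
theorem isSliceBoundKernel_backKernel_heatKernelGrad (v : E) :
    IsSliceBoundKernel (backKernel (heatKernelGrad v))
      (fun τ => (2 : ℝ) ^ ((Module.finrank ℝ E : ℝ) / 2) * ‖v‖ * (1 + |τ| ^ (-(1 / 2 : ℝ)))) := by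
  obtain ⟨C, hC, hCb⟩ := exists_abs_heatKernelGrad_le_of_le (E := E)
  refine isSliceBoundKernel_backKernel (by positivity) (continuousOn_heatKernelGrad_family v)
    (fun ε hε => ⟨C * ‖v‖ * ε ^ (-(((Module.finrank ℝ E : ℝ) + 1) / 2)), ?_,
      fun a ha y => hCb hε ha v y⟩) fun a ha => lintegral_enorm_heatKernelGrad_le_model ha v
  have : 0 ≤ ε ^ (-(((Module.finrank ℝ E : ℝ) + 1) / 2)) := Real.rpow_nonneg hε.le _
  positivity

end General

/-! ### The Newtonian families (dimension three) -/

section Newton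

/-- Local notation for `ℝ³ = EuclideanSpace ℝ (Fin 3)`. -/
local notation "ℝ³" => EuclideanSpace ℝ (Fin 3)

variable {r₀ r₁ : ℝ}

/-- `dim ℝ³ = 3` (local copy). [folklore] -/
private theorem finrank_R3'' : Module.finrank ℝ ℝ³ = 3 := by simp

/-- Joint continuity of `(a, y) ↦ heatD1 a c φ (y)` on `(0, ∞) × E` for `φ ∈ L¹`. [folklore] -/
theorem continuousOn_heatD1_family {E : Type*} [NormedAddCommGroup E] [InnerProductSpace ℝ E]
    [FiniteDimensional ℝ E] [MeasurableSpace E] [BorelSpace E] {φ : E → ℝ} (hφ : MemLp φ 1 volume)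
    (c : E) : ContinuousOn (fun q : ℝ × E => heatD1 q.1 c φ q.2) (Ioi 0 ×ˢ univ) :=
  UnboundedOperators.continuousOn_uncurry_fderiv_heatExtension_of_memLp hφ le_rfl c

/-- Sup bound for `heatD1 a c φ`, `φ ∈ L¹`, uniformly for `a ≥ ε`. [folklore] -/
theorem exists_abs_heatD1_le_of_le {E : Type*} [NormedAddCommGroup E] [InnerProductSpace ℝ E]
    [FiniteDimensional ℝ E] [MeasurableSpace E] [BorelSpace E] {φ : E → ℝ} (hφ : MemLp φ 1 volume)
    (c : E) {ε : ℝ} (hε : 0 < ε) :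
    ∃ B : ℝ, 0 ≤ B ∧ ∀ a, ε ≤ a → ∀ y, |heatD1 a c φ y| ≤ B := by
  refine ⟨(4 * π * ε) ^ (-(Module.finrank ℝ E : ℝ) / 2) * (Real.sqrt ε)⁻¹ * ‖c‖ *
    (eLpNorm φ 1 volume).toReal, by positivity, fun a ha y => ?_⟩
  rw [← Real.norm_eq_abs]
  exact norm_heatD1_le_of_le hφ hε ha c y

/-- Slice bound for `heatD1 a c φ`, `φ ∈ L¹`: `∫ |heatD1 a c φ| ≤ 2^{d/2}‖c‖‖φ‖₁ (1 + a^{-1/2})`.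
[folklore] -/
theorem lintegral_enorm_heatD1_le_model {E : Type*} [NormedAddCommGroup E] [InnerProductSpace ℝ E]
    [FiniteDimensional ℝ E] [MeasurableSpace E] [BorelSpace E] {φ : E → ℝ} (hφ : MemLp φ 1 volume)
    (c : E) {a : ℝ} (ha : 0 < a) :
    ∫⁻ y, ‖heatD1 a c φ y‖ₑ ≤ ENNReal.ofReal
      ((2 : ℝ) ^ ((Module.finrank ℝ E : ℝ) / 2) * ‖c‖ * (eLpNorm φ 1 volume).toReal *
        (1 + |a| ^ (-(1 / 2 : ℝ)))) := by
  have h := UnboundedOperators.eLpNorm_fderiv_heatExtension_apply_le hφ le_rfl ha c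
  rw [eLpNorm_one_eq_lintegral_enorm] at h
  have hfin : eLpNorm φ 1 volume ≠ ⊤ := hφ.eLpNorm_ne_top
  refine h.trans ?_
  conv_lhs => rw [← ENNReal.ofReal_toReal hfin]
  rw [← ENNReal.ofReal_mul (by positivity)]
  refine ENNReal.ofReal_le_ofReal ?_
  rw [abs_of_pos ha]
  set T : ℝ := (eLpNorm φ 1 volume).toReal with hT
  have hT0 : 0 ≤ T := ENNReal.toReal_nonneg
  have h0 : 0 ≤ a ^ (-(1 / 2 : ℝ)) := Real.rpow_nonneg ha.le _
  have h1 : 0 ≤ (2 : ℝ) ^ ((Module.finrank ℝ E : ℝ) / 2) * ‖c‖ * T := by positivity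
  nlinarith

/-- **`heatD1 · c Γ₀` gives a slice-bound backward kernel.** [folklore] -/
theorem isSliceBoundKernel_backKernel_heatD1_newtonNear (h₀ : 0 < r₀) (h₁ : r₀ < r₁) (c : ℝ³) :
    IsSliceBoundKernel (backKernel fun a y => heatD1 a c (newtonNear r₀ r₁) y)
      (fun τ => (2 : ℝ) ^ ((Module.finrank ℝ ℝ³ : ℝ) / 2) * ‖c‖ *
        (eLpNorm (newtonNear r₀ r₁) 1 volume).toReal * (1 + |τ| ^ (-(1 / 2 : ℝ)))) :=
  isSliceBoundKernel_backKernel (by positivity) (continuousOn_heatD1_family (memLp_one_newtonNear h₀ h₁) c)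
    (fun ε hε => exists_abs_heatD1_le_of_le (memLp_one_newtonNear h₀ h₁) c hε)
    fun a ha => lintegral_enorm_heatD1_le_model (memLp_one_newtonNear h₀ h₁) c ha

/-- **`heatD1 · c Γ₀` gives an off-diagonal backward kernel on `{δ ≤ ‖y‖}`.** [folklore] -/
theorem isOffDiagKernel_backKernel_heatD1_newtonNear (h₀ : 0 < r₀) (h₁ : r₀ < r₁) {δ : ℝ}
    (hδ : 0 < δ) (c : ℝ³) :
    IsOffDiagKernel (backKernel fun a y => heatD1 a c (newtonNear r₀ r₁) y) {y | δ ≤ ‖y‖} := by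
  obtain ⟨B, hB0, hB⟩ := exists_abs_heatD1_newtonNear_le_of_le_norm h₀ h₁ hδ c
  exact isOffDiagKernel_backKernel (continuousOn_heatD1_family (memLp_one_newtonNear h₀ h₁) c)
    ⟨B, hB0, fun a ha y hy => hB ha y hy⟩

/-- **`heatD2 · v c Γ₀` gives an off-diagonal backward kernel on `{δ ≤ ‖y‖}`.** [folklore] -/
theorem isOffDiagKernel_backKernel_heatD2_newtonNear (h₀ : 0 < r₀) (h₁ : r₀ < r₁) {δ : ℝ}
    (hδ : 0 < δ) (v c : ℝ³) :
    IsOffDiagKernel (backKernel fun a y => heatD2 a v c (newtonNear r₀ r₁) y) {y | δ ≤ ‖y‖} := by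
  obtain ⟨B, hB0, hB⟩ := exists_abs_heatD2_newtonNear_le_of_le_norm h₀ h₁ hδ v c
  exact isOffDiagKernel_backKernel (continuousOn_uncurry_heatD2 (memLp_one_newtonNear h₀ h₁) v c)
    ⟨B, hB0, fun a ha y hy => hB ha y hy⟩

/-- **`heatD1 · c λ` gives an off-diagonal backward kernel on all of `ℝ³`** (`λ` smooth).
[folklore] -/
theorem isOffDiagKernel_backKernel_heatD1_newtonFarLaplacian (h₀ : 0 < r₀) (h₁ : r₀ < r₁)
    (c : ℝ³) :
    IsOffDiagKernel (backKernel fun a y => heatD1 a c (newtonFarLaplacian r₀ r₁) y) univ := by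
  obtain ⟨B, hB0, hB⟩ := exists_abs_heatD1_newtonFarLaplacian_le h₀ h₁ c
  exact isOffDiagKernel_backKernel
    (continuousOn_heatD1_family (memLp_one_newtonFarLaplacian h₀ h₁) c)
    ⟨B, hB0, fun a ha y _ => hB ha y⟩

/-- Sup bound for `heatD3 a u v w φ`, `φ ∈ L¹(ℝ³)`, uniformly for `a ≥ ε`, `‖u‖, ‖v‖ ≤ 1`
(three layers at the clock `a/3 ≥ ε/3`). [folklore] -/
theorem exists_abs_heatD3_le_of_le {φ : ℝ³ → ℝ} (hφ : MemLp φ 1 volume) {u v : ℝ³}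
    (hu : ‖u‖ ≤ 1) (hv : ‖v‖ ≤ 1) (w : ℝ³) {ε : ℝ} (hε : 0 < ε) :
    ∃ B : ℝ, 0 ≤ B ∧ ∀ a, ε ≤ a → ∀ y, |heatD3 a u v w φ y| ≤ B := by
  have hε3 : 0 < ε / 3 := by positivity
  -- the `L^∞` norm of `∂_wG_{a/3}` for `a ≥ ε`
  set K : ℝ := (4 * π * (ε / 3)) ^ (-(Module.finrank ℝ ℝ³ : ℝ) / 2) * (Real.sqrt (ε / 3))⁻¹ * ‖w‖
    with hK
  have hK0 : 0 ≤ K := by rw [hK]; positivity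
  have hfin : eLpNorm φ 1 volume ≠ ⊤ := hφ.eLpNorm_ne_top
  refine ⟨27 * (ε⁻¹) * (K * (eLpNorm φ 1 volume).toReal), by positivity, fun a ha y => ?_⟩
  have ha0 : 0 < a := hε.trans_le ha
  have ha3 : 0 < a / 3 := by positivity
  haveI : (∞ : ℝ≥0∞).HolderConjugate 1 := ENNReal.HolderConjugate.top_one
  have h := enorm_heatD3_le_dim3 finrank_R3'' hφ le_rfl ha0 hu hv y ∞ (w := w)
  -- bound the kernel norm at the clock `a/3 ≥ ε/3`
  have hKa : eLpNorm (fun z => fderiv ℝ (UnboundedOperators.heatKernel (E := ℝ³) (a / 3)) z w) ∞ volume ≤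
      ENNReal.ofReal K := by
    refine (UnboundedOperators.eLpNorm_top_fderiv_heatKernel_apply_le ha3 w).trans
      (ENNReal.ofReal_le_ofReal ?_)
    rw [hK]
    have hle : ε / 3 ≤ a / 3 := by linarith
    refine mul_le_mul_of_nonneg_right (mul_le_mul ?_ ?_ (by positivity) (by positivity)) (norm_nonneg _)
    · exact Real.rpow_le_rpow_of_nonpos (by positivity) (by nlinarith [Real.pi_pos])
        (by rw [neg_div]; exact neg_nonpos.2 (by positivity))
    · exact inv_anti₀ (Real.sqrt_pos.2 hε3) (Real.sqrt_le_sqrt hle)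
  have h27 : ENNReal.ofReal (27 * a⁻¹) ≤ ENNReal.ofReal (27 * ε⁻¹) :=
    ENNReal.ofReal_le_ofReal (by gcongr)
  have htot : ‖heatD3 a u v w φ y‖ₑ ≤ ENNReal.ofReal (27 * ε⁻¹) * (ENNReal.ofReal K * eLpNorm φ 1 volume) :=
    h.trans (mul_le_mul' h27 (mul_le_mul' hKa le_rfl))
  rw [← Real.norm_eq_abs, ← toReal_enorm]
  have hne : ENNReal.ofReal (27 * ε⁻¹) * (ENNReal.ofReal K * eLpNorm φ 1 volume) ≠ ∞ :=
    ENNReal.mul_ne_top ENNReal.ofReal_ne_top (ENNReal.mul_ne_top ENNReal.ofReal_ne_top hfin)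
  calc (‖heatD3 a u v w φ y‖ₑ).toReal
      ≤ (ENNReal.ofReal (27 * ε⁻¹) * (ENNReal.ofReal K * eLpNorm φ 1 volume)).toReal :=
        ENNReal.toReal_mono hne htot
    _ = 27 * ε⁻¹ * (K * (eLpNorm φ 1 volume).toReal) := by
        rw [ENNReal.toReal_mul, ENNReal.toReal_mul, ENNReal.toReal_ofReal (by positivity),
          ENNReal.toReal_ofReal hK0]

/-- **`heatD3 · u v w Γ₀` gives a slice-bound backward kernel** for `‖u‖, ‖v‖, ‖w‖ ≤ 1`, with
majorant `C (1 + |τ|^{-1/2})` from `exists_lintegral_enorm_heatD3_newtonNear_le`. [folklore] -/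
theorem exists_isSliceBoundKernel_backKernel_heatD3_newtonNear (h₀ : 0 < r₀) (h₁ : r₀ < r₁)
    {u v w : ℝ³} (hu : ‖u‖ ≤ 1) (hv : ‖v‖ ≤ 1) (hw : ‖w‖ ≤ 1) :
    ∃ C : ℝ, 0 < C ∧ IsSliceBoundKernel (backKernel fun a y => heatD3 a u v w (newtonNear r₀ r₁) y)
      (fun τ => C * (1 + |τ| ^ (-(1 / 2 : ℝ)))) := by
  obtain ⟨C, hC, hL⟩ := exists_lintegral_enorm_heatD3_newtonNear_le h₀ h₁ u v w hu hv hw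
  refine ⟨C, hC, isSliceBoundKernel_backKernel hC.le
    (continuousOn_uncurry_heatD3 (memLp_one_newtonNear h₀ h₁) u v w)
    (fun ε hε => exists_abs_heatD3_le_of_le (memLp_one_newtonNear h₀ h₁) hu hv w hε)
    fun a ha => ?_⟩
  rw [abs_of_pos ha]; exact hL ha

end Newton

end Literature.Analysis.FluidPDE
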